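import Mathlib
import HarnessLib
import Literature.MathematicalPhysics.StatisticalMechanics.TunedFlowRepresentation

/-!
# The last-scale functional `K_N ↦ ∫ K_N(Λ) dμ_{N+1}` of the free-energy representation:
# the tuned-flow identity `∫ (e^{−ℋ} ∘_0 K̂_0)(Λ) dμ^{(q)} = 1 + ∫ K_N(Λ) dμ_{N+1}` and LINEARITY bounds
# ([ABKM19] Ch. 4.2–4.4 with Ch. 12)

Continuation of `TunedFlowRepresentation.lean` (there: the norm form `‖∫ … − 1‖ ≤ εη^N A⁻¹A_𝒫`).  The
smoothness half of [ABKM19] Theorem 2.2 reads the free energy off the representation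
`𝒵_N(𝒦) = Z₀ κ e^{|Λ|λ(ℋ)} (1 + ∫ K_N(Λ) dμ_{N+1}^{(q(ℋ))})` and needs the last factor as a FUNCTION of the
final activity `K_N` of the tuned trajectory (and of the seed `ℋ` through `q(ℋ)`), with difference
bounds.  This file supplies the `K_N`-slot (the `q`-slot is Lemma 8.4 at the last scale, elsewhere):

* **`integral_flowStart_eq_one_add_integral_last_of_isTunedQ`** — the identity form of the tuned-flow
  representation: `∫ (e^{−ℋ} ∘_0 K̂_0(𝒦,ℋ))(Λ) d(tailMeasure 𝒞s N N) = 1 + ∫ y_N(Λ, φ) μ_{N+1}(dφ)`,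
  `y_N = RGFlow.fwd rgSQ (initAct 𝒦 x₀) x N` the final activity (on the connected block `Λ` the
  multiplicative extension is the activity itself);
* **`norm_integral_last_sub_le_abkm`**, **`norm_integral_last_secondDiff_le_abkm`** — the functional
  `y ↦ ∫ y(Λ) dμ_{N+1}` is linear on the admissible `N`-activities, hence its two- and four-point
  differences are bounded by `A⁻¹A_𝒫` times the weak norm of `y − y'`, resp. `Σ± y`
  (`norm_integral_last_le_abkm` + integrability from `StepKernelBounds`): the hypotheses `hΦ1`, `hΦ4`
  of `RGFlow.norm_lastScale_sub_le` / `RGFlow.norm_secondDiff_lastScale_le` for the torus data, with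
  `c_I = A⁻¹A_𝒫`, uniformly in the volume.

Everything is proved; no named fact.

## References
* S. Adams, S. Buchholz, R. Kotecký, S. Müller, arXiv:1910.13564, Ch. 4.2–4.4 (4.9)–(4.12), Ch. 12
  (12.2), (12.9), Theorem 2.2 [AdamsBuchholzKoteckyMuller2019].
-/

noncomputable section

namespace Literature.MathematicalPhysics.StatisticalMechanics.GradientRG

open scoped BigOperators Classical
open Finset Matrix MeasureTheory
open Literature.MathematicalPhysics.StatisticalMechanics.TorusPolymer
  (IsPolymer Separated blocks polys bprod pcirc blockOf boxCorner thicken numBlocks mem_polys mem_blocks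
    isPolymer_blockOf isPolymer_empty isPolymer_univ)
open Literature.Barriers.CriticalPhenomena.LongRangePhi4.Polymer (IsConn components)
open Literature.MathematicalPhysics.QuantumFieldTheory
open Literature.Dynamics.Hyperbolic

variable {d M : ℕ} [NeZero M]

/-! ## Linearity of the last-scale functional on admissible activities -/

section Linear

variable {L N Mord R n p r₀ : ℕ} {θbar lam μ δ₁ δ₀ A𝒫 A𝒫' C₂ h A : ℝ}
  {𝒞 𝒞s : ℕ → (Fin d → ZMod M) → ℝ}

/-- Integrability of `K(Λ, ·)` under `μ_{N+1}` for an admissible `N`-activity (weak norm finite,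
`StepKernelBounds` at the last scale). [cite: AdamsBuchholzKoteckyMuller2019, Ch. 4.4 (∫|K_N| ≤ ‖K_N‖)] -/
theorem integrable_last_of_mem_activitySpace (hLodd : Odd L) (hM : M = L ^ N)
    (hB : AbkmWeightBounds L N Mord R n θbar lam μ δ₁ δ₀ A𝒫 𝒞
      (abkmWeightData L N Mord R θbar (schedDelta δ₀ δ₁ N) 𝒞))
    (hSN : StepKernelBounds (abkmWeightData L N Mord R θbar (schedDelta δ₀ δ₁ N) 𝒞) L N A𝒫' C₂ (𝒞s (N + 1)))
    (hA : 0 < A) (y : activitySpace (abkmNormParams L N Mord R p r₀ h θbar A (schedDelta δ₀ δ₁ N) 𝒞) N) :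
    Integrable (fun φ => (y : Finset (Fin d → ZMod M) → ((Fin d → ZMod M) → ℝ) → ℂ) univ φ)
      (stepMeasure (𝒞s (N + 1))) := by
  have hMo : Odd M := by rw [hM]; exact hLodd.pow
  have hΛp : IsPolymer (L ^ N) (univ : Finset (Fin d → ZMod M)) := isPolymer_univ _
  have hΛc : IsConn (univ : Finset (Fin d → ZMod M)) := isConn_top_univ hMo
  obtain ⟨C, hC⟩ := activitySpace.exists_weakNormLE y
  have hMt : M = (abkmNormParams L N Mord R p r₀ h θbar A (schedDelta δ₀ δ₁ N) 𝒞).L ^ N * L ^ 0 := by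
    show M = L ^ N * L ^ 0
    rw [pow_zero, mul_one]; exact hM
  have hC0 : 0 ≤ C :=
    nonneg_of_weakNormLE (P := abkmNormParams L N Mord R p r₀ h θbar A (schedDelta δ₀ δ₁ N) 𝒞) hA hMt
      hLodd.pow hLodd.pow hC
  have hint0 := integrable_comp_add_of_weakNormLE_of_stepKernelBounds (p := p) (r₀ := r₀) hB hSN hA hC0 hC
    (activitySpace.contDiff y) (fun X hX hc => activitySpace.isGaugeLocal y hX hc) hΛp hΛc 0
  refine hint0.congr (ae_of_all _ fun ξ => ?_)
  simp

/-- **Two-point differences of the last-scale functional** (`hΦ1` of `RGFlow.norm_lastScale_sub_le` for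
the torus data, `c_I = A⁻¹A_𝒫`): for admissible `N`-activities `y, y'` with `‖y − y'‖_N ≤ c`,
`‖∫ y(Λ) dμ_{N+1} − ∫ y'(Λ) dμ_{N+1}‖ ≤ c · A⁻¹ · A_𝒫` — linearity of the integral plus
`norm_integral_last_le_abkm`; uniform in the volume. [cite: AdamsBuchholzKoteckyMuller2019, Ch. 4.4 (4.12)] -/
theorem norm_integral_last_sub_le_abkm (hLodd : Odd L) (hM : M = L ^ N)
    (hB : AbkmWeightBounds L N Mord R n θbar lam μ δ₁ δ₀ A𝒫 𝒞
      (abkmWeightData L N Mord R θbar (schedDelta δ₀ δ₁ N) 𝒞))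
    (hSN : StepKernelBounds (abkmWeightData L N Mord R θbar (schedDelta δ₀ δ₁ N) 𝒞) L N A𝒫' C₂ (𝒞s (N + 1)))
    (hA : 0 < A) (y y' : activitySpace (abkmNormParams L N Mord R p r₀ h θbar A (schedDelta δ₀ δ₁ N) 𝒞) N)
    {c : ℝ} (hc : activityNormLE (abkmNormParams L N Mord R p r₀ h θbar A (schedDelta δ₀ δ₁ N) 𝒞) N (y - y') c) :
    ‖(∫ φ, (y : Finset (Fin d → ZMod M) → ((Fin d → ZMod M) → ℝ) → ℂ) univ φ ∂(stepMeasure (𝒞s (N + 1))))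
        - ∫ φ, (y' : Finset (Fin d → ZMod M) → ((Fin d → ZMod M) → ℝ) → ℂ) univ φ ∂(stepMeasure (𝒞s (N + 1)))‖
      ≤ c * A⁻¹ * A𝒫' := by
  have hMt : M = (abkmNormParams L N Mord R p r₀ h θbar A (schedDelta δ₀ δ₁ N) 𝒞).L ^ N * L ^ 0 := by
    show M = L ^ N * L ^ 0
    rw [pow_zero, mul_one]; exact hM
  have hc0 : 0 ≤ c :=
    nonneg_of_weakNormLE (P := abkmNormParams L N Mord R p r₀ h θbar A (schedDelta δ₀ δ₁ N) 𝒞) hA hMt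
      hLodd.pow hLodd.pow hc
  have hint := integrable_last_of_mem_activitySpace (p := p) (r₀ := r₀) hLodd hM hB hSN hA y
  have hint' := integrable_last_of_mem_activitySpace (p := p) (r₀ := r₀) hLodd hM hB hSN hA y'
  rw [← integral_sub hint hint']
  have e : (fun φ => (y : Finset (Fin d → ZMod M) → ((Fin d → ZMod M) → ℝ) → ℂ) univ φ
      - (y' : Finset (Fin d → ZMod M) → ((Fin d → ZMod M) → ℝ) → ℂ) univ φ)
      = fun φ => ((y - y' : activitySpace (abkmNormParams L N Mord R p r₀ h θbar A (schedDelta δ₀ δ₁ N) 𝒞) N) :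
          Finset (Fin d → ZMod M) → ((Fin d → ZMod M) → ℝ) → ℂ) univ φ := by
    funext φ
    rw [Submodule.coe_sub, Pi.sub_apply, Pi.sub_apply]
  rw [e]
  exact norm_integral_last_le_abkm (p := p) (r₀ := r₀) hLodd hM hB hSN hA hc0 hc
    (fun X hX hcn => activitySpace.isGaugeLocal (y - y') hX hcn)

/-- **Four-point differences of the last-scale functional** (`hΦ4` of
`RGFlow.norm_secondDiff_lastScale_le` for the torus data, `c_I = A⁻¹A_𝒫`): for admissible
`N`-activities with `‖y₁₁ − y₁₀ − y₀₁ + y₀₀‖_N ≤ c`, `‖Σ± ∫ y_{ij}(Λ) dμ_{N+1}‖ ≤ c · A⁻¹ · A_𝒫`.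
[cite: AdamsBuchholzKoteckyMuller2019, Ch. 4.4 (4.12)] -/
theorem norm_integral_last_secondDiff_le_abkm (hLodd : Odd L) (hM : M = L ^ N)
    (hB : AbkmWeightBounds L N Mord R n θbar lam μ δ₁ δ₀ A𝒫 𝒞
      (abkmWeightData L N Mord R θbar (schedDelta δ₀ δ₁ N) 𝒞))
    (hSN : StepKernelBounds (abkmWeightData L N Mord R θbar (schedDelta δ₀ δ₁ N) 𝒞) L N A𝒫' C₂ (𝒞s (N + 1)))
    (hA : 0 < A)
    (y₁₁ y₁₀ y₀₁ y₀₀ : activitySpace (abkmNormParams L N Mord R p r₀ h θbar A (schedDelta δ₀ δ₁ N) 𝒞) N)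
    {c : ℝ} (hc : activityNormLE (abkmNormParams L N Mord R p r₀ h θbar A (schedDelta δ₀ δ₁ N) 𝒞) N
      (y₁₁ - y₁₀ - y₀₁ + y₀₀) c) :
    ‖(∫ φ, (y₁₁ : Finset (Fin d → ZMod M) → ((Fin d → ZMod M) → ℝ) → ℂ) univ φ ∂(stepMeasure (𝒞s (N + 1))))
        - (∫ φ, (y₁₀ : Finset (Fin d → ZMod M) → ((Fin d → ZMod M) → ℝ) → ℂ) univ φ ∂(stepMeasure (𝒞s (N + 1))))
        - (∫ φ, (y₀₁ : Finset (Fin d → ZMod M) → ((Fin d → ZMod M) → ℝ) → ℂ) univ φ ∂(stepMeasure (𝒞s (N + 1))))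
        + ∫ φ, (y₀₀ : Finset (Fin d → ZMod M) → ((Fin d → ZMod M) → ℝ) → ℂ) univ φ ∂(stepMeasure (𝒞s (N + 1)))‖
      ≤ c * A⁻¹ * A𝒫' := by
  have hMt : M = (abkmNormParams L N Mord R p r₀ h θbar A (schedDelta δ₀ δ₁ N) 𝒞).L ^ N * L ^ 0 := by
    show M = L ^ N * L ^ 0
    rw [pow_zero, mul_one]; exact hM
  have hc0 : 0 ≤ c :=
    nonneg_of_weakNormLE (P := abkmNormParams L N Mord R p r₀ h θbar A (schedDelta δ₀ δ₁ N) 𝒞) hA hMt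
      hLodd.pow hLodd.pow hc
  have h₁₁ := integrable_last_of_mem_activitySpace (p := p) (r₀ := r₀) hLodd hM hB hSN hA y₁₁
  have h₁₀ := integrable_last_of_mem_activitySpace (p := p) (r₀ := r₀) hLodd hM hB hSN hA y₁₀
  have h₀₁ := integrable_last_of_mem_activitySpace (p := p) (r₀ := r₀) hLodd hM hB hSN hA y₀₁
  have h₀₀ := integrable_last_of_mem_activitySpace (p := p) (r₀ := r₀) hLodd hM hB hSN hA y₀₀
  have h2 : Integrable (fun φ => (y₁₁ : Finset (Fin d → ZMod M) → ((Fin d → ZMod M) → ℝ) → ℂ) univ φ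
      - (y₁₀ : Finset (Fin d → ZMod M) → ((Fin d → ZMod M) → ℝ) → ℂ) univ φ) (stepMeasure (𝒞s (N + 1))) :=
    h₁₁.sub h₁₀
  have h3 : Integrable (fun φ => (y₁₁ : Finset (Fin d → ZMod M) → ((Fin d → ZMod M) → ℝ) → ℂ) univ φ
      - (y₁₀ : Finset (Fin d → ZMod M) → ((Fin d → ZMod M) → ℝ) → ℂ) univ φ
      - (y₀₁ : Finset (Fin d → ZMod M) → ((Fin d → ZMod M) → ℝ) → ℂ) univ φ) (stepMeasure (𝒞s (N + 1))) :=
    h2.sub h₀₁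
  rw [← integral_sub h₁₁ h₁₀, ← integral_sub h2 h₀₁, ← integral_add h3 h₀₀]
  have e : (fun φ => (y₁₁ : Finset (Fin d → ZMod M) → ((Fin d → ZMod M) → ℝ) → ℂ) univ φ
      - (y₁₀ : Finset (Fin d → ZMod M) → ((Fin d → ZMod M) → ℝ) → ℂ) univ φ
      - (y₀₁ : Finset (Fin d → ZMod M) → ((Fin d → ZMod M) → ℝ) → ℂ) univ φ
      + (y₀₀ : Finset (Fin d → ZMod M) → ((Fin d → ZMod M) → ℝ) → ℂ) univ φ)
      = fun φ => ((y₁₁ - y₁₀ - y₀₁ + y₀₀ :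
          activitySpace (abkmNormParams L N Mord R p r₀ h θbar A (schedDelta δ₀ δ₁ N) 𝒞) N) :
          Finset (Fin d → ZMod M) → ((Fin d → ZMod M) → ℝ) → ℂ) univ φ := by
    funext φ
    rw [Submodule.coe_add, Submodule.coe_sub, Submodule.coe_sub]
    simp only [Pi.add_apply, Pi.sub_apply]
  rw [e]
  exact norm_integral_last_le_abkm (p := p) (r₀ := r₀) hLodd hM hB hSN hA hc0 hc
    (fun X hX hcn => activitySpace.isGaugeLocal (y₁₁ - y₁₀ - y₀₁ + y₀₀) hX hcn)

end Linear

/-! ## The tuned-flow identity -/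

section Tuned

variable {L N Mord R n p r₀ : ℕ} {θbar lam μ δ₁ δ₀ A𝒫 A𝒫' C₂ h A : ℝ}
  {𝒞 𝒞s : ℕ → (Fin d → ZMod M) → ℝ}

set_option maxHeartbeats 1600000 in
/-- **The partition functional along a tuned trajectory, IDENTITY form** (module docstring): in the
setting of `norm_integral_flowStart_sub_one_le_of_isTunedQ` (torus data, step kernels `𝒞s` with
`StepKernelBounds`, zero sum, evenness, signed finite range, `B_k` acting as `opB`, a trajectory `x` with
`RGFlow.IsTunedQ`/`RGFlow.InTubeQ` for `(rgA, B, rgSQ, initAct 𝒦 x₀)`, `ε ≤ r ≤ 1/64`):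
`∫ (e^{−ℋ} ∘_0 K̂_0(𝒦,ℋ))(Λ) d(μ_1 ∗ ⋯ ∗ μ_{N+1}) = 1 + ∫ K_N(Λ, φ) μ_{N+1}(dφ)` with `K_N = y_N` the FINAL
ACTIVITY of the trajectory (`RGFlow.fwd rgSQ (initAct 𝒦 x₀) x N`, read on the single connected
`N`-block `Λ`) — the last-scale functional of the free-energy representation, LINEAR in `K_N`.
[cite: AdamsBuchholzKoteckyMuller2019, Ch. 4.4 (4.11)–(4.12) / Ch. 12 (12.9)] -/
theorem integral_flowStart_eq_one_add_integral_last_of_isTunedQ [Fact (0 < h)] [Fact (0 < L)]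
    (hd : 3 ≤ d) (hLodd : Odd L) (hL : 2 ^ (d + 3) + 16 * R ≤ L) (hR2 : 2 ≤ R) (hM : M = L ^ N)
    (hp : d / 2 + 2 ≤ p) (hp4 : 4 * p ≤ 2 ^ (d + 2)) (hpM : p + d ≤ Mord) (hMR : Mord ≤ R) (hr₀ : 3 ≤ r₀)
    (hB : AbkmWeightBounds L N Mord R n θbar lam μ δ₁ δ₀ A𝒫 𝒞
      (abkmWeightData L N Mord R θbar (schedDelta δ₀ δ₁ N) 𝒞))
    (hδ₀ : 0 < δ₀) (hδ₁ : 0 < δ₁) (hh0 : hZeroSq d R δ₀ δ₁ ≤ h ^ 2)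
    (hS : ∀ k, k ≤ N → StepKernelBounds (abkmWeightData L N Mord R θbar (schedDelta δ₀ δ₁ N) 𝒞) L k A𝒫' C₂ (𝒞s (k + 1)))
    (h0s : ∀ k, k + 1 ≤ N → ∑ x, 𝒞s (k + 1) x = 0 ∧ ∀ x, 𝒞s (k + 1) (-x) = 𝒞s (k + 1) x)
    (hranges : ∀ k, k + 1 ≤ N → ∃ m : ℝ, m ≤ 0 ∧
      ∀ x : Fin d → ZMod M, ((L : ℝ) ^ (k + 1)) / 2 ≤ (GradientFRD.supNorm x : ℝ) → 𝒞s (k + 1) x = m)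
    (hh2 : C₂ ≤ h ^ 2) (hA𝒫 : 0 ≤ A𝒫') (hA1 : 1 ≤ A) (hA𝒫A : A𝒫' ≤ A)
    (hsmall : (2 : ℝ) ^ (L ^ d) * (A𝒫' * A ^ (-(1 - (1 + 1 / ((2 * (2 ^ d + 1) + 6 : ℝ) ^ d))⁻¹) : ℝ)) ≤ 1)
    {r : ℝ} (hr : r ≤ 1 / 64)
    (hv : vABKM d R A A𝒫' r ≤ 1 / 64) (hωA : omegaABKM d R A A𝒫' r * A ^ 2 ≤ 1)
    (hc3A : (kappaABKM d R A A𝒫' r) ^ (L ^ d) * ((2 * (2 * (kappaABKM d R A A𝒫' r) * max 1 A𝒫')) ^ ((2 ^ (d + 1) + 2) ^ d * L ^ d) * (4 : ℝ) ^ ((2 ^ (d + 1) + 2) ^ d * L ^ d)) ≤ A ^ ((1 + 1 / ((2 * (2 ^ d + 1) + 6 : ℝ) ^ d)) - 1 : ℝ))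
    (hc2A : (kappaABKM d R A A𝒫' r) ^ (L ^ d) * ((2 * (kappaABKM d R A A𝒫' r) * max 1 A𝒫') ^ ((2 ^ (d + 1) + 2) ^ d * L ^ d) * (2 : ℝ) ^ ((2 ^ (d + 1) + 2) ^ d * L ^ d)) ≤ A ^ ((1 + 1 / ((2 * (2 ^ d + 1) + 6 : ℝ) ^ d)) - 1 : ℝ))
    {η ε : ℝ} (hη : 0 < η) (hη1 : η ≤ 1) (hε : 0 ≤ ε) (hεr : ε ≤ r)
    {𝒦 : (Fin d → ℝ) → ℂ} {x₀ : HamSpace ℂ d (fieldWt h (L : ℝ) d 0) ((L : ℝ) ^ 0) (L ^ (d * 0))}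
    (hmem₀ : restrictConn (L ^ 0) (initKH 𝒦 (HamSpace.toHam x₀)) ∈
      activitySpace (abkmNormParams L N Mord R p r₀ h θbar A (schedDelta δ₀ δ₁ N) 𝒞) 0)
    {B : ∀ k, activitySpace (abkmNormParams L N Mord R p r₀ h θbar A (schedDelta δ₀ δ₁ N) 𝒞) k →+
      HamSpace ℂ d (fieldWt h (L : ℝ) d (k + 1)) ((L : ℝ) ^ (k + 1)) (L ^ (d * (k + 1)))}
    (hBeq : ∀ k, k < N → ∀ y : activitySpace (abkmNormParams L N Mord R p r₀ h θbar A (schedDelta δ₀ δ₁ N) 𝒞) k,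
      HamSpace.toHam (B k y) = opB (abkmStepData L R k 𝒞s) (y : Finset (Fin d → ZMod M) → ((Fin d → ZMod M) → ℝ) → ℂ))
    {x : ∀ k, HamSpace ℂ d (fieldWt h (L : ℝ) d k) ((L : ℝ) ^ k) (L ^ (d * k))}
    (htraj : RGFlow.IsTunedQ (E := fun k => HamSpace ℂ d (fieldWt h (L : ℝ) d k) ((L : ℝ) ^ k) (L ^ (d * k)))
      (F := fun k => activitySpace (abkmNormParams L N Mord R p r₀ h θbar A (schedDelta δ₀ δ₁ N) 𝒞) k)
      N (rgA L h 𝒞s) B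
      (rgSQ (L := L) (N := N) (Mord := Mord) (R := R) (p := p) (r₀ := r₀) (h := h) (θbar := θbar) (A := A)
        (δ₀ := δ₀) (δ₁ := δ₁) (𝒞 := 𝒞) 𝒞s)
      (initAct (N := N) (Mord := Mord) (R := R) (p := p) (r₀ := r₀) (θbar := θbar) (A := A) (δ₀ := δ₀)
        (δ₁ := δ₁) (𝒞 := 𝒞) 𝒦 x₀) x)
    (htube : RGFlow.InTubeQ (E := fun k => HamSpace ℂ d (fieldWt h (L : ℝ) d k) ((L : ℝ) ^ k) (L ^ (d * k)))
      (F := fun k => activitySpace (abkmNormParams L N Mord R p r₀ h θbar A (schedDelta δ₀ δ₁ N) 𝒞) k)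
      N η ε (activityNormLE (abkmNormParams L N Mord R p r₀ h θbar A (schedDelta δ₀ δ₁ N) 𝒞))
      (rgSQ (L := L) (N := N) (Mord := Mord) (R := R) (p := p) (r₀ := r₀) (h := h) (θbar := θbar) (A := A)
        (δ₀ := δ₀) (δ₁ := δ₁) (𝒞 := 𝒞) 𝒞s)
      (initAct (N := N) (Mord := Mord) (R := R) (p := p) (r₀ := r₀) (θbar := θbar) (A := A) (δ₀ := δ₀)
        (δ₁ := δ₁) (𝒞 := 𝒞) 𝒦 x₀) x)
    (hx₀ : x 0 = x₀) :
    ∫ φ, pcirc 1 (fun V => expNegH (HamSpace.toHam x₀) V φ) (fun U => initKH 𝒦 (HamSpace.toHam x₀) U φ) univ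
        ∂(tailMeasure 𝒞s N N) =
      1 + ∫ φ, ((RGFlow.fwd
        (rgSQ (L := L) (N := N) (Mord := Mord) (R := R) (p := p) (r₀ := r₀) (h := h) (θbar := θbar) (A := A)
          (δ₀ := δ₀) (δ₁ := δ₁) (𝒞 := 𝒞) 𝒞s)
        (initAct (N := N) (Mord := Mord) (R := R) (p := p) (r₀ := r₀) (θbar := θbar) (A := A) (δ₀ := δ₀)
          (δ₁ := δ₁) (𝒞 := 𝒞) 𝒦 x₀) x N :
            activitySpace (abkmNormParams L N Mord R p r₀ h θbar A (schedDelta δ₀ δ₁ N) 𝒞) N) :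
          Finset (Fin d → ZMod M) → ((Fin d → ZMod M) → ℝ) → ℂ) univ φ ∂(stepMeasure (𝒞s (N + 1))) := by
  set P := abkmNormParams L N Mord R p r₀ h θbar A (schedDelta δ₀ δ₁ N) 𝒞 with hP
  have hh : 0 < h := Fact.out
  have hd2 : 2 ≤ d := by omega
  have hp1 : d / 2 + 1 ≤ p := by omega
  have hMord : d / 2 + 1 ≤ Mord := by omega
  have hpR : p ≤ R := by omega
  have hA : 0 < A := by linarith
  have hL0 : (0 : ℝ) < L := by exact_mod_cast hLodd.pos
  have hMo : Odd M := by rw [hM]; exact hLodd.pow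
  -- the trajectory as a flow `(H_k, K_k)`
  set y : ∀ k, activitySpace P k := RGFlow.fwd
    (rgSQ (L := L) (N := N) (Mord := Mord) (R := R) (p := p) (r₀ := r₀) (h := h) (θbar := θbar) (A := A)
      (δ₀ := δ₀) (δ₁ := δ₁) (𝒞 := 𝒞) 𝒞s)
    (initAct (N := N) (Mord := Mord) (R := R) (p := p) (r₀ := r₀) (θbar := θbar) (A := A) (δ₀ := δ₀)
      (δ₁ := δ₁) (𝒞 := 𝒞) 𝒦 x₀) x with hy
  set Hs : ℕ → RelevantHamiltonian ℂ d := fun k => HamSpace.toHam (x k) with hHs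
  set Ks : ℕ → Finset (Fin d → ZMod M) → ((Fin d → ZMod M) → ℝ) → ℂ :=
    fun k => mulExt (y k : Finset (Fin d → ZMod M) → ((Fin d → ZMod M) → ℝ) → ℂ) with hKs
  -- tube bounds
  have hεη : ∀ k, ε * η ^ k ≤ ε := fun k =>
    mul_le_of_le_one_right hε (pow_le_one₀ hη.le hη1)
  have hxn : ∀ k, k ≤ N → ‖x k‖ ≤ ε * η ^ k := fun k hk => (htube k hk).1
  have hyn : ∀ k, k ≤ N → activityNormLE P k (y k) (ε * η ^ k) := fun k hk => (htube k hk).2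
  have hH : ∀ k, k ≤ N → hamNorm (fieldWt h (L : ℝ) d k) ((L : ℝ) ^ k) (L ^ (d * k)) (Hs k) ≤ 1 / 8 := by
    intro k hk
    have := hxn k hk
    rw [HamSpace.norm_def] at this
    exact this.trans ((hεη k).trans (hεr.trans (by linarith)))
  have hHr : ∀ k, k ≤ N → hamNorm (fieldWt h (L : ℝ) d k) ((L : ℝ) ^ k) (L ^ (d * k)) (Hs k) ≤ r := by
    intro k hk
    have := hxn k hk
    rw [HamSpace.norm_def] at this
    exact this.trans ((hεη k).trans hεr)
  have hC : ∀ k, 0 ≤ ε * η ^ k := fun k => mul_nonneg hε (pow_nonneg hη.le k)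
  have hK : ∀ k, k ≤ N → WeakNormLE P k (Ks k) (ε * η ^ k) := fun k hk =>
    activitySpace.weakNormLE_mulExt (y k) (hyn k hk)
  have hKr : ∀ k, k ≤ N → WeakNormLE P k (Ks k) r := fun k hk =>
    (hK k hk).mono hA ((hεη k).trans hεr)
  have hKfac : ∀ k, k ≤ N → Factorises (L ^ k) (Ks k) := fun k _ =>
    factorises_mulExt (Nat.one_le_pow _ _ hLodd.pos)
  have hK0 : ∀ k φ, Ks k ∅ φ = 1 := fun k φ => mulExt_empty φ
  have hKd : ∀ k Y, ContDiff ℝ r₀ (Ks k Y) := fun k Y => activitySpace.contDiff_mulExt (y k) Y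
  have hKloc : ∀ k, k ≤ N → ∀ Y, IsPolymer (L ^ k) Y → IsConn Y → IsGaugeLocal (P.gauge k Y) (Ks k Y) :=
    fun k _ Y hY hc => activitySpace.isGaugeLocal_mulExt (y k) hY hc
  have hKt : ∀ k, TransInv (L ^ k) (Ks k) := fun k => activitySpace.transInv_mulExt (y k)
  -- membership of `S(H_k, K_k)` on the ball, and the recursion for `K_{k+1}`
  have hmem : ∀ k, k < N → restrictConn (L ^ (k + 1)) (nextKStep (abkmStepData L R k 𝒞s) (Hs k) (Ks k)) ∈
      activitySpace P (k + 1) := by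
    intro k hk
    exact restrictConn_nextKStep_mem_activitySpace_of_stepKernelBounds hd hLodd hL hR2 hM hk hp hpM hMR hr₀ hB
      hδ₀ hδ₁ hh hh0 hh2 hA𝒫 hA1 hA𝒫A hsmall (abkmStepData L R k 𝒞s) rfl rfl (hS k hk.le) (x₀ := 0) rfl rfl
      (hHr k hk.le) hr (hKr k hk.le) (hKfac k hk.le) (hK0 k) (hKd k) (hKloc k hk.le) (hKt k) hv hωA hc3A hc2A
  have hyS : ∀ k, k < N → (y (k + 1) : Finset (Fin d → ZMod M) → ((Fin d → ZMod M) → ℝ) → ℂ) =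
      restrictConn (L ^ (k + 1)) (nextKStep (abkmStepData L R k 𝒞s) (Hs k) (Ks k)) := by
    intro k hk
    have h1 : y (k + 1) = rgSQ (L := L) (N := N) (Mord := Mord) (R := R) (p := p) (r₀ := r₀) (h := h) (θbar := θbar)
        (A := A) (δ₀ := δ₀) (δ₁ := δ₁) (𝒞 := 𝒞) 𝒞s k (x k) (y k) := by
      rw [hy, RGFlow.fwd_succ]
    rw [h1]
    exact coe_rgSQ_of_mem (hmem k hk)
  have hKstep : ∀ k, k < N → ∀ U, IsPolymer (L ^ (k + 1)) U → ∀ φ,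
      Ks (k + 1) U φ = nextKStep (abkmStepData L R k 𝒞s) (Hs k) (Ks k) U φ := by
    intro k hk U hU φ
    obtain ⟨t, ht⟩ : ∃ t, N = (k + 1) + t := ⟨N - (k + 1), by omega⟩
    have hMt : M = L ^ (k + 1) * L ^ t := by rw [← pow_add, ← ht]; exact hM
    obtain ⟨m, hm, hrange⟩ := hranges k hk
    have hfac : Factorises (L ^ (k + 1)) (nextKStep (abkmStepData L R k 𝒞s) (Hs k) (Ks k)) :=
      factorises_nextKStep_abkm (Mord := Mord) (r₀ := r₀) (θbar := θbar) (A := A) (δ₀ := δ₀) (δ₁ := δ₁) (𝒞 := 𝒞)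
        hLodd hL hM hk hp1 hp4 hh (h0s k hk).1 (h0s k hk).2
        (fun φ _ => pos_of_posSemidef_circulant (hS k hk.le).posSemidef φ) hm hrange (Hs k) (hKfac k hk.le) (hK0 k)
        (fun Y => (hKd k Y).continuous.measurable) (hKloc k hk.le)
    have h := mulExt_restrictConn_eq_of_factorises hMt hLodd.pow hLodd.pow hfac
      (nextKStep_empty _ _ (hK0 k)) hU
    show mulExt (y (k + 1) : Finset (Fin d → ZMod M) → ((Fin d → ZMod M) → ℝ) → ℂ) U φ = _
    rw [hyS k hk, h]
  -- the recursion for `H_{k+1}`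
  have hHstep : ∀ k, k < N → Hs (k + 1) = nextH (abkmStepData L R k 𝒞s) (Hs k) (Ks k) := by
    intro k hk
    set D := abkmStepData L R k 𝒞s with hDdef
    obtain ⟨t, ht⟩ : ∃ t, N = k + t := ⟨N - k, by omega⟩
    have hMt0 : M = L ^ k * L ^ t := by rw [← pow_add, ← ht]; exact hM
    have htodd : Odd (L ^ t) := hLodd.pow
    have hC𝒞 : (Matrix.circulant D.𝒞).PosSemidef := (hS k hk.le).posSemidef
    have hB₀ : D.B₀ = blockOf (L ^ k) 0 := rfl
    have hc₀ : D.c₀ = boxCorner (L ^ k) (starRad R L d k) 0 := rfl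
    have hBne : D.B₀.card ≠ 0 := by
      rw [hB₀]; exact (card_pos.2 ⟨0, TorusPolymer.mem_blockOf_self _ 0⟩).ne'
    obtain ⟨hwrap0, hroom0⟩ := abkm_box_lt (d := d) hL hpR hk
    have hwrap : 4 * ((L ^ k - 1) / 2 + starRad R L d k) < M := by rw [hM]; exact hwrap0
    have hroomB : ∀ z ∈ D.B₀, HasRoom D.c₀ z (d / 2 + 1) := by
      intro z hz
      have hzS : z ∈ thicken (starRad R L d k) (blockOf (L ^ k) 0) := by
        rw [← hB₀]; exact TorusPolymer.subset_thicken _ _ hz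
      have hin := (TorusPolymer.mem_thicken_blockOf_iff_inBox hMt0 hLodd.pow htodd hwrap 0 z).1 hzS
      rw [hc₀]
      refine TorusPolymer.hasRoom_of_inBox hin ?_
      have h2 : ((2 * ((L ^ k - 1) / 2 + starRad R L d k) : ℕ) + ((d / 2 + 1 : ℕ) : ℤ)) * 2 < (M : ℤ) := by
        have : (2 * ((L ^ k - 1) / 2 + starRad R L d k) + (d / 2 + 1)) * 2 < M := by
          rw [hM]; have := hroom0; omega
        exact_mod_cast this
      exact_mod_cast h2
    have hBconn : IsConn D.B₀ := by rw [hB₀]; exact TorusPolymer.isConn_blockOf hMo hLodd.pow 0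
    rw [nextH_eq D hC𝒞 hBne hroomB (Hs k) (Ks k)]
    show HamSpace.toHam (x (k + 1)) = _
    rw [htraj.rel k hk, map_add, rgA, toHam_stepOpAEquiv, hBeq k hk, hKs]
    simp only
    rw [opB_mulExt D hBconn]
    rfl
  -- the iterated identity
  have hflow := integral_flow_eq_abkm (p := p) (r₀ := r₀) (C := fun k => ε * η ^ k) hd hLodd hM hp1 hMord hB hS hδ₀ hδ₁ hh
    hh0 hA hH hC hK hKfac hK0 hKd hKloc hHstep hKstep
  -- identify the two ends
  have hK0eq : Ks 0 = initKH 𝒦 (HamSpace.toHam x₀) := by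
    funext X
    show mulExt (y 0 : Finset (Fin d → ZMod M) → ((Fin d → ZMod M) → ℝ) → ℂ) X = _
    rw [hy, RGFlow.fwd_zero]
    exact mulExt_initAct hLodd hM hmem₀ X
  have hH0 : Hs 0 = HamSpace.toHam x₀ := by
    show HamSpace.toHam (x 0) = _; rw [hx₀]
  have hHN : Hs N = 0 := by
    show HamSpace.toHam (x N) = 0; rw [htraj.final]; rfl
  have hstart : (fun φ => pcirc 1 (fun V => expNegH (HamSpace.toHam x₀) V φ) (fun U => initKH 𝒦 (HamSpace.toHam x₀) U φ) univ) =
      fun φ => pcirc (L ^ 0) (fun V => expNegH (Hs 0) V φ) (fun U => Ks 0 U φ) univ := by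
    funext φ; rw [pow_zero L, hH0, hK0eq]
  rw [hstart, hflow, hHN]
  rw [integral_last_scale_abkm (p := p) (r₀ := r₀) hLodd hM hB (hS N le_rfl) hA (hC N) (hK N le_rfl) (hK0 N) (hKd N)
    (hKloc N le_rfl)]
  -- `Λ` is connected at scale `N`: the multiplicative extension reads `K_N(Λ)` itself
  congr 1
  refine integral_congr_ae (ae_of_all _ fun φ => ?_)
  show mulExt (y N : Finset (Fin d → ZMod M) → ((Fin d → ZMod M) → ℝ) → ℂ) univ φ = _
  rw [mulExt_of_isConn (isConn_top_univ hMo)]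

end Tuned

end Literature.MathematicalPhysics.StatisticalMechanics.GradientRG

end
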